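import Summits.ABC.ABC.Theorems.IneffectiveSubspaceUniformSadicTowerFourHeavyCollapse

/-!
# `UniformSadicTowerFour` (stmt-ABC-14937), line `flat-steep-split` (lead c4): the `T`-PART FACE `G(W)`
# — level-one rung ⟹ `G` ⟹ BoundedOmegaABC, so modulo crux #6 the crux IS `G`

The crux `UniformSadicTowerFour` ("Ridout at level four") gives, unconditionally and at every budget `K`,
the LEVEL-ONE RUNG (`MixedRadical.levelOneRung_of_uniformSadicTowerFour`): for every `ε > 0` there is `C`
with `c < C · ((∏_{p ∈ S} p) · {abc}^S)^(1+ε)` for every abc triple `(a, b, c)` and every set `S` of at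
most `K` primes, where `{m}^S := ∏_{ℓ ∣ m, ℓ ∉ S} ℓ^{v_ℓ(m)}` is the `S`-free part of `m`; and modulo the
route's other load-bearing crux #6 `DeepRegimeABC` (stmt-ABC-15121) the crux is EQUIVALENT to
BoundedOmegaABC, abc with `C(W, ε)` on every bounded-`ω` cell `{ω(abc) ≤ W}`
(`HeavyPlaces.uniformSadicTowerFour_iff_boundedOmega_of_deepRegimeABC`).  This file reads the rung on
the face "`S` covers two of the three terms" and calibrates the line against the resulting statement
**`G(W)`** (inlined verbatim in every signature; no definition):

  for every `ε > 0` there is `C = C(W, ε) > 0` such that for every set `T` of at most `W` primes and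
  all coprime `0 < v < u` with `ω(uv) ≤ W`,
  `∏_{p ∈ T} p^{v_p(u − v)} ≤ C · ((∏_{p ∈ T} p) · rad(uv))^(1+ε) · u^ε`

— "the `T`-part of a difference of two coprime numbers with at most `W` prime factors is small, with
linear loss in `∏_{p ∈ T} p`".

* `tPart_of_levelOneRung` — the level-one rung (every budget) implies `G(W)` for every `W`
  (constant `C(2W, ε)` of the rung);
* `boundedOmega_of_tPart` — `G` (every `W`) implies BoundedOmegaABC;
* `tPart_of_uniformSadicTowerFour` — hence the crux implies `G`;
* `uniformSadicTowerFour_iff_tPart_of_deepRegimeABC` — under crux #6, `UniformSadicTowerFour ⟺ G`.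

So modulo #6 the crux IS `G`: whatever proves the crux proves exactly that the `T`-part of `u − v` is
controlled by `(∏_{p∈T} p) · rad(uv)` with an `u^ε` loss, uniformly in `|T|, ω(uv) ≤ W`.

**Proofs.** (1) `tPart_of_levelOneRung`.  Fix `W, ε` and take the rung's constant `C` at budget `2W`.
Given `T, u, v`, the triple `(v, u − v, u)` is an abc triple; put `S := T ∪ supp(uv)` (`|S| ≤ 2W`, all
prime) and let `D := ∏_{p∈T} p^{v_p(u−v)}` be the `T`-part, `N := v (u − v) u`.  A prime `ℓ` of `N`
outside `S` divides neither `u` nor `v`, so `v_ℓ(N) = v_ℓ(u − v)`; hence `{N}^S · D` is the product of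
`ℓ^{v_ℓ(u−v)}` over the DISTINCT primes of `(supp N ∖ S) ∪ T` and divides `u − v ≤ u` (`tPart_dvd`),
while `∏_{p∈S} p ≤ (∏_{p∈T} p) · ∏_{p ∣ uv} p` (`tPart_bracket_mul_le`).  Multiplying the rung
`u < C · ((∏_{p∈S} p) · {N}^S)^(1+ε)` by `D^(1+ε)` gives
`u · D^(1+ε) < C · ((∏_{p∈T} p) · rad(uv))^(1+ε) · u^(1+ε)`, and `D ≤ D^(1+ε)` (`tPart_real_face`).
(2) `boundedOmega_of_tPart`.  Fix `W, ε`, put `ε' := min ε 1 / 3` and take `C₀ := C(W, ε')` of `G`.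
Given an abc triple `(a, b, c)` with `ω(abc) ≤ W` and, by symmetry, `a ≤ b`, apply `G(W)` to
`T := supp(b)`, `u := c`, `v := a` (`0 < a < c`, `c ⊥ a`, `supp(ca), supp(b) ⊆ supp(abc)`): here
`u − v = b`, the `T`-part of `b` is `b` itself and `(∏_{p ∣ b} p) · rad(ca) = rad(abc)` (`b ⊥ ca`,
`tPart_rad_face`), so `b ≤ C₀ · rad(abc)^(1+ε') · c^{ε'}` and `c ≤ 2b`.  Absorbing the small power
(`tPart_real_absorb`: `c^(1−ε') ≤ 2C₀ · rad^(1+ε')`) gives `c ≤ (2C₀)^(1/(1−ε')) · rad^((1+ε')/(1−ε'))`,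
and `(1+ε')/(1−ε') ≤ 1 + ε`, `rad ≥ 1`; the constant `2 · (2C₀)^(1/(1−ε'))` makes it strict.

Sources: the crux notes of stmt-ABC-14937, line `flat-steep-split` (skeleton v5, stub `TPartFace`,
lead c4); the arguments are elementary unique factorisation and real bookkeeping [folklore].  Mathlib
only (`Finset.prod_dvd_of_isRelPrime`, `Nat.coprime_pow_primes`, `Nat.ordProj_dvd`,
`Nat.factorization_mul`, `Nat.prod_primeFactors_pow_factorization`, `Nat.radical_eq_prod_primeFactors`,
`UniqueFactorizationMonoid.radical_mul`, `Finset.prod_union_inter`, `Real.mul_rpow`, `Real.rpow_add`,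
`Real.rpow_sub`, `Real.rpow_mul`, `Real.rpow_le_rpow`, `Real.rpow_le_rpow_of_exponent_le`,
`Real.self_le_rpow_of_one_le`) plus the landed `MixedRadical.levelOneRung_of_uniformSadicTowerFour` and
`HeavyPlaces.uniformSadicTowerFour_iff_boundedOmega_of_deepRegimeABC` (used only in the two closing
corollaries).  No new definitions.  Deliberately NOT here: `G` itself (OPEN, abc-type; ≡ the crux
modulo #6).
-/

noncomputable section

-- `Summit.<Summit>.<Problem>` is the mandated summit-side namespace (CONVENTIONS §2); for the
-- single-conjunct summit `ABC` the two coincide, so the duplicate `ABC.ABC` is deliberate.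
set_option linter.dupNamespace false

namespace Summit.ABC.ABC.Theorems.UniformSadicTowerFour.BoundedOmega

open Literature.NumberTheory.DiophantineGeometry (IsABCTriple rad rad_def)
open Summit.ABC.ABC.Theses.IneffectiveSubspace (UniformSadicTowerFour DeepRegimeABC)
open Summit.ABC.ABC.Theorems.UniformSadicTowerFour.MixedRadical (levelOneRung_of_uniformSadicTowerFour)
open Summit.ABC.ABC.Theorems.UniformSadicTowerFour.HeavyPlaces
  (uniformSadicTowerFour_iff_boundedOmega_of_deepRegimeABC)
open scoped BigOperators
open UniqueFactorizationMonoid (radical)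

/-! ## Arithmetic of `T`-parts -/

/-- **`T`-parts divide.** For a finite set `A` of primes and any `m`, `∏_{p ∈ A} p^{v_p(m)} ∣ m`: the
prime powers `p^{v_p(m)} ∣ m` are pairwise coprime. [folklore] -/
theorem tPart_dvd (m : ℕ) {A : Finset ℕ} (hA : ∀ p ∈ A, p.Prime) :
    ∏ p ∈ A, p ^ m.factorization p ∣ m := by
  refine Finset.prod_dvd_of_isRelPrime ?_ fun p _ => Nat.ordProj_dvd m p
  intro p hp q hq hpq
  exact Nat.coprime_iff_isRelPrime.1 (Nat.coprime_pow_primes _ _ (hA p hp) (hA q hq) hpq)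

/-- **`T`-parts are positive:** `0 < ∏_{p ∈ A} p^{v_p(m)}` for a set `A` of primes. [folklore] -/
theorem tPart_pos (m : ℕ) {A : Finset ℕ} (hA : ∀ p ∈ A, p.Prime) :
    0 < ∏ p ∈ A, p ^ m.factorization p :=
  Finset.prod_pos fun p hp => pow_pos (hA p hp).pos _

/-- **The bracket bound on the face.** For `0 < v < u` and a set `T` of primes, with
`S := T ∪ supp(uv)` and `N := v (u − v) u`: the level-one bracket `(∏_{p∈S} p) · {N}^S` of the triple
`(v, u − v, u)` times the `T`-part `∏_{p∈T} p^{v_p(u−v)}` is at most `(∏_{p∈T} p) · rad(uv) · (u − v)`.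
Indeed a prime `ℓ` of `N` outside `S` divides neither `u` nor `v`, so `v_ℓ(N) = v_ℓ(u − v)` and
`{N}^S · (T-part)` is the product of `ℓ^{v_ℓ(u−v)}` over the distinct primes of `(supp N ∖ S) ∪ T`, which
divides `u − v` (`tPart_dvd`); and `∏_{p∈S} p ≤ (∏_{p∈T} p) · ∏_{p ∣ uv} p`. [folklore] -/
theorem tPart_bracket_mul_le {u v : ℕ} (hv : 0 < v) (hvu : v < u) {T : Finset ℕ}
    (hT : ∀ p ∈ T, p.Prime) :
    (∏ p ∈ T ∪ (u * v).primeFactors, p) *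
        (∏ p ∈ (v * (u - v) * u).primeFactors \ (T ∪ (u * v).primeFactors),
          p ^ (v * (u - v) * u).factorization p) *
        ∏ p ∈ T, p ^ (u - v).factorization p ≤
      (∏ p ∈ T, p) * radical (u * v) * (u - v) := by
  have hu0 : u ≠ 0 := by omega
  have hv0 : v ≠ 0 := hv.ne'
  have hm0 : u - v ≠ 0 := by omega
  -- outside `S` the exponents of `N` are those of `u - v`
  have hexp : ∀ p ∈ (v * (u - v) * u).primeFactors \ (T ∪ (u * v).primeFactors),
      p ^ (v * (u - v) * u).factorization p = p ^ (u - v).factorization p := by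
    intro p hp
    obtain ⟨hpN, hpS⟩ := Finset.mem_sdiff.1 hp
    have hp' : p.Prime := Nat.prime_of_mem_primeFactors hpN
    have hpuv : ¬p ∣ u * v := fun hd =>
      hpS (Finset.mem_union_right _ (Nat.mem_primeFactors.2 ⟨hp', hd, mul_ne_zero hu0 hv0⟩))
    have hpu : u.factorization p = 0 :=
      Nat.factorization_eq_zero_of_not_dvd fun hd => hpuv (hd.mul_right v)
    have hpv : v.factorization p = 0 :=
      Nat.factorization_eq_zero_of_not_dvd fun hd => hpuv (hd.mul_left u)
    rw [Nat.factorization_mul (mul_ne_zero hv0 hm0) hu0, Nat.factorization_mul hv0 hm0]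
    simp [hpu, hpv]
  have hdisj : Disjoint ((v * (u - v) * u).primeFactors \ (T ∪ (u * v).primeFactors)) T :=
    Finset.disjoint_left.2 fun p hp hpT =>
      (Finset.mem_sdiff.1 hp).2 (Finset.mem_union_left _ hpT)
  have hprime : ∀ p ∈ (v * (u - v) * u).primeFactors \ (T ∪ (u * v).primeFactors) ∪ T, p.Prime := by
    intro p hp
    rcases Finset.mem_union.1 hp with h₁ | h₁
    · exact Nat.prime_of_mem_primeFactors (Finset.mem_sdiff.1 h₁).1
    · exact hT p h₁
  -- `{N}^S · (T-part) ≤ u - v`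
  have hFD : (∏ p ∈ (v * (u - v) * u).primeFactors \ (T ∪ (u * v).primeFactors),
        p ^ (v * (u - v) * u).factorization p) * ∏ p ∈ T, p ^ (u - v).factorization p ≤ u - v := by
    rw [Finset.prod_congr rfl hexp, ← Finset.prod_union hdisj]
    exact Nat.le_of_dvd (Nat.pos_of_ne_zero hm0) (tPart_dvd (u - v) hprime)
  -- `∏_{p ∈ S} p ≤ (∏_{p ∈ T} p) · rad(uv)`
  have hSle : ∏ p ∈ T ∪ (u * v).primeFactors, p ≤ (∏ p ∈ T, p) * radical (u * v) := by
    rw [Nat.radical_eq_prod_primeFactors, ← Finset.prod_union_inter]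
    exact Nat.le_mul_of_pos_right _
      (Finset.prod_pos fun p hp => (hT p (Finset.mem_inter.1 hp).1).pos)
  rw [mul_assoc]
  exact Nat.mul_le_mul hSle hFD

/-- **The radical on the face.** For an abc triple `(a, b, c)`: `(∏_{p ∣ b} p) · rad(ca) = rad(abc)`
(`b` is coprime to `ca`, and the radical is multiplicative on coprime numbers). [folklore] -/
theorem tPart_rad_face {a b c : ℕ} (habc : IsABCTriple a b c) :
    (∏ p ∈ b.primeFactors, p) * radical (c * a) = rad a b c := by
  obtain ⟨-, -, hsum, hcop⟩ := habc
  have hb : Nat.Coprime b (c * a) := by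
    rw [← hsum]
    exact Nat.Coprime.mul_right (Nat.coprime_add_self_right.2 hcop.symm) hcop.symm
  rw [← Nat.radical_eq_prod_primeFactors, rad_def,
    ← UniqueFactorizationMonoid.radical_mul (Nat.coprime_iff_isRelPrime.1 hb),
    show b * (c * a) = a * b * c by ring]

/-! ## Real bookkeeping -/

/-- **Real step of the face.** From the rung `u < C · B^(1+ε)`, the bracket bound `B · D ≤ R · u` and
`1 ≤ D`, `0 < u`: `u · D^(1+ε) < C · (B D)^(1+ε) ≤ C · (R u)^(1+ε) = C R^(1+ε) u^ε · u`, hence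
`D ≤ D^(1+ε) ≤ C · R^(1+ε) · u^ε`. [folklore] -/
theorem tPart_real_face {B D R u : ℕ} {C ε : ℝ} (hε : 0 < ε) (hC : 0 < C) (hD : 0 < D) (hu : 0 < u)
    (hkey : (u : ℝ) < C * ((B : ℕ) : ℝ) ^ (1 + ε)) (hBD : B * D ≤ R * u) :
    ((D : ℕ) : ℝ) ≤ C * ((R : ℕ) : ℝ) ^ (1 + ε) * ((u : ℕ) : ℝ) ^ ε := by
  have hD1 : (1 : ℝ) ≤ D := by exact_mod_cast hD
  have hu0 : (0 : ℝ) < u := by exact_mod_cast hu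
  have hBDR : (B : ℝ) * D ≤ (R : ℝ) * u := by exact_mod_cast hBD
  have hε1 : (0 : ℝ) ≤ 1 + ε := by linarith
  have hlt : (D : ℝ) ^ (1 + ε) * u < C * (R : ℝ) ^ (1 + ε) * (u : ℝ) ^ ε * u :=
    calc (D : ℝ) ^ (1 + ε) * u < (D : ℝ) ^ (1 + ε) * (C * (B : ℝ) ^ (1 + ε)) :=
          mul_lt_mul_of_pos_left hkey (Real.rpow_pos_of_pos (by linarith) _)
      _ = C * ((B : ℝ) * D) ^ (1 + ε) := by
          rw [Real.mul_rpow (Nat.cast_nonneg _) (Nat.cast_nonneg _)]; ring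
      _ ≤ C * ((R : ℝ) * u) ^ (1 + ε) :=
          mul_le_mul_of_nonneg_left (Real.rpow_le_rpow (by positivity) hBDR hε1) hC.le
      _ = C * (R : ℝ) ^ (1 + ε) * (u : ℝ) ^ ε * u := by
          rw [Real.mul_rpow (Nat.cast_nonneg _) hu0.le, Real.rpow_add hu0, Real.rpow_one]; ring
  calc (D : ℝ) ≤ (D : ℝ) ^ (1 + ε) := Real.self_le_rpow_of_one_le hD1 (by linarith)
    _ ≤ C * (R : ℝ) ^ (1 + ε) * (u : ℝ) ^ ε := (lt_of_mul_lt_mul_right hlt hu0.le).le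

/-- **Absorbing a small power.** If `1 ≤ X`, `0 < A`, `1 ≤ R`, `θ < 1` and `X ≤ A · R^s · X^θ`, then
`X ≤ A^(1/(1−θ)) · R^(s/(1−θ))` (`X^(1−θ) ≤ A R^s`, then raise to the power `1/(1−θ) > 0`). [folklore] -/
theorem tPart_real_absorb {X A R s θ : ℝ} (hX : 1 ≤ X) (hA : 0 < A) (hR : 1 ≤ R) (hθ : θ < 1)
    (h : X ≤ A * R ^ s * X ^ θ) : X ≤ A ^ (1 / (1 - θ)) * R ^ (s / (1 - θ)) := by
  have hX0 : 0 < X := by linarith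
  have hR0 : 0 ≤ R := by linarith
  have h1θ : 0 < 1 - θ := by linarith
  have h1 : X ^ (1 - θ) ≤ A * R ^ s := by
    rw [Real.rpow_sub hX0, Real.rpow_one, div_le_iff₀ (Real.rpow_pos_of_pos hX0 θ)]
    exact h
  calc X = (X ^ (1 - θ)) ^ (1 / (1 - θ)) := by
        rw [← Real.rpow_mul hX0.le, mul_one_div_cancel h1θ.ne', Real.rpow_one]
    _ ≤ (A * R ^ s) ^ (1 / (1 - θ)) :=
        Real.rpow_le_rpow (Real.rpow_nonneg hX0.le _) h1 (one_div_pos.2 h1θ).le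
    _ = A ^ (1 / (1 - θ)) * R ^ (s / (1 - θ)) := by
        rw [Real.mul_rpow hA.le (Real.rpow_nonneg hR0 s), ← Real.rpow_mul hR0, mul_one_div]

/-! ## The face: level-one rung ⟹ `G` ⟹ BoundedOmegaABC -/

/-- **Level-one rung (every budget) ⟹ `G(W)` (every `W`).** With the rung's constant `C(2W, ε)`: for every
set `T` of at most `W` primes and all coprime `0 < v < u` with `ω(uv) ≤ W`, the `T`-part
`∏_{p∈T} p^{v_p(u−v)}` of `u − v` is at most `C · ((∏_{p∈T} p) · rad(uv))^(1+ε) · u^ε` — read the rung at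
`S := T ∪ supp(uv)` on the abc triple `(v, u − v, u)` (`tPart_bracket_mul_le`, `tPart_real_face`).
[folklore] -/
theorem tPart_of_levelOneRung
    (h : ∀ K : ℕ, ∀ ε : ℝ, 0 < ε → ∃ C : ℝ, 0 < C ∧ ∀ S : Finset ℕ, S.card ≤ K → (∀ p ∈ S, Nat.Prime p) →
      ∀ a b c : ℕ, IsABCTriple a b c →
        (c : ℝ) < C * ((((∏ p ∈ S, p) *
          ∏ p ∈ (a * b * c).primeFactors \ S, p ^ (a * b * c).factorization p : ℕ) : ℝ)) ^ (1 + ε)) :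
    ∀ W : ℕ, ∀ ε : ℝ, 0 < ε → ∃ C : ℝ, 0 < C ∧ ∀ T : Finset ℕ, T.card ≤ W → (∀ p ∈ T, Nat.Prime p) →
      ∀ u v : ℕ, 0 < v → v < u → Nat.Coprime u v → (u * v).primeFactors.card ≤ W →
        ((∏ p ∈ T, p ^ (u - v).factorization p : ℕ) : ℝ) ≤
          C * (((∏ p ∈ T, p) * radical (u * v) : ℕ) : ℝ) ^ (1 + ε) * (u : ℝ) ^ ε := by
  intro W ε hε
  obtain ⟨C, hC, hW⟩ := h (W + W) ε hε
  refine ⟨C, hC, fun T hTW hT u v hv hvu huv hω => ?_⟩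
  -- the abc triple `(v, u - v, u)`, read at `S := T ∪ supp(uv)`
  have habc : IsABCTriple v (u - v) u :=
    ⟨hv, Nat.sub_pos_of_lt hvu, by omega, (Nat.coprime_sub_self_right hvu.le).2 huv.symm⟩
  have hcard : (T ∪ (u * v).primeFactors).card ≤ W + W :=
    (Finset.card_union_le _ _).trans (add_le_add hTW hω)
  have hprime : ∀ p ∈ T ∪ (u * v).primeFactors, p.Prime := fun p hp => by
    rcases Finset.mem_union.1 hp with h₁ | h₁
    exacts [hT p h₁, Nat.prime_of_mem_primeFactors h₁]
  exact tPart_real_face hε hC (tPart_pos _ hT) (hv.trans hvu) (hW _ hcard hprime v (u - v) u habc)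
    ((tPart_bracket_mul_le hv hvu hT).trans (Nat.mul_le_mul_left _ (Nat.sub_le u v)))

/-- **`G` (every `W`) ⟹ BoundedOmegaABC.** For an abc triple `(a, b, c)` with `ω(abc) ≤ W` and (by
symmetry) `a ≤ b`, `G(W)` at `ε' := min ε 1 / 3` applied to `T := supp(b)`, `u := c`, `v := a` reads
`b ≤ C₀ · rad(abc)^(1+ε') · c^{ε'}` (`u − v = b` is its own `T`-part; `(∏_{p∣b} p)·rad(ca) = rad(abc)`,
`tPart_rad_face`); with `c ≤ 2b` and `tPart_real_absorb`,
`c ≤ (2C₀)^(1/(1−ε')) · rad(abc)^((1+ε')/(1−ε')) ≤ (2C₀)^(1/(1−ε')) · rad(abc)^(1+ε)`. [folklore] -/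
theorem boundedOmega_of_tPart
    (hG : ∀ W : ℕ, ∀ ε : ℝ, 0 < ε → ∃ C : ℝ, 0 < C ∧ ∀ T : Finset ℕ, T.card ≤ W →
      (∀ p ∈ T, Nat.Prime p) →
      ∀ u v : ℕ, 0 < v → v < u → Nat.Coprime u v → (u * v).primeFactors.card ≤ W →
        ((∏ p ∈ T, p ^ (u - v).factorization p : ℕ) : ℝ) ≤
          C * (((∏ p ∈ T, p) * radical (u * v) : ℕ) : ℝ) ^ (1 + ε) * (u : ℝ) ^ ε) :
    ∀ W : ℕ, ∀ ε : ℝ, 0 < ε → ∃ C : ℝ, 0 < C ∧ ∀ a b c : ℕ, IsABCTriple a b c →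
      (a * b * c).primeFactors.card ≤ W → (c : ℝ) < C * ((rad a b c : ℕ) : ℝ) ^ (1 + ε) := by
  intro W ε hε
  have hδ0 : 0 < min ε 1 := lt_min hε one_pos
  have hδ1 : min ε 1 ≤ 1 := min_le_right ε 1
  have hδε : min ε 1 ≤ ε := min_le_left ε 1
  obtain ⟨C₀, hC₀, hG'⟩ := hG W (min ε 1 / 3) (by positivity)
  refine ⟨2 * (2 * C₀) ^ (1 / (1 - min ε 1 / 3)), by positivity, fun a b c habc hω => ?_⟩
  -- by symmetry `a ≤ b`
  wlog hab : a ≤ b generalizing a b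
  · obtain ⟨ha, hb, hsum, hcop⟩ := habc
    have h' := this b a ⟨hb, ha, by omega, hcop.symm⟩ (by rwa [mul_comm b a]) (not_le.1 hab).le
    rwa [rad_def, mul_comm b a, ← rad_def] at h'
  obtain ⟨ha, hb, hsum, hcop⟩ := habc
  have hc0 : c ≠ 0 := by omega
  have habc0 : a * b * c ≠ 0 := mul_ne_zero (mul_ne_zero ha.ne' hb.ne') hc0
  -- `G(W)` at `T := supp(b)`, `u := c`, `v := a`
  have hTcard : b.primeFactors.card ≤ W :=
    (Finset.card_le_card (Nat.primeFactors_mono ⟨a * c, by ring⟩ habc0)).trans hω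
  have hca : (c * a).primeFactors.card ≤ W :=
    (Finset.card_le_card (Nat.primeFactors_mono ⟨b, by ring⟩ habc0)).trans hω
  have hcopca : Nat.Coprime c a := by
    rw [← hsum]
    exact Nat.coprime_self_add_left.2 hcop.symm
  have key := hG' b.primeFactors hTcard (fun p hp => Nat.prime_of_mem_primeFactors hp) c a ha
    (by omega) hcopca hca
  rw [show c - a = b by omega, ← Nat.prod_primeFactors_pow_factorization hb.ne',
    tPart_rad_face ⟨ha, hb, hsum, hcop⟩] at key
  -- `key : b ≤ C₀ · rad(abc)^(1+ε') · c^ε'`; absorb `c^ε'`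
  have hc1 : (1 : ℝ) ≤ c := by exact_mod_cast Nat.pos_of_ne_zero hc0
  have hrad1 : (1 : ℝ) ≤ ((rad a b c : ℕ) : ℝ) := by
    rw [rad_def]
    exact_mod_cast Nat.radical_pos _
  have h2b : (c : ℝ) ≤ 2 * b := by exact_mod_cast (show c ≤ 2 * b by omega)
  have hcle : (c : ℝ) ≤
      2 * C₀ * ((rad a b c : ℕ) : ℝ) ^ (1 + min ε 1 / 3) * (c : ℝ) ^ (min ε 1 / 3) := by
    have h0 : (0 : ℝ) ≤ ((rad a b c : ℕ) : ℝ) ^ (1 + min ε 1 / 3) * (c : ℝ) ^ (min ε 1 / 3) := by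
      positivity
    calc (c : ℝ) ≤ 2 * b := h2b
      _ ≤ 2 * (C₀ * ((rad a b c : ℕ) : ℝ) ^ (1 + min ε 1 / 3) * (c : ℝ) ^ (min ε 1 / 3)) := by
          linarith
      _ = _ := by ring
  have habs := tPart_real_absorb hc1 (by positivity) hrad1 (by linarith) hcle
  have hexp : (1 + min ε 1 / 3) / (1 - min ε 1 / 3) ≤ 1 + ε := by
    rw [div_le_iff₀ (by linarith)]
    nlinarith [mul_nonneg (sub_nonneg.2 hδε) (by linarith : (0 : ℝ) ≤ 1 - min ε 1 / 3),
      mul_nonneg hδ0.le (sub_nonneg.2 hδ1)]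
  have hpos : (0 : ℝ) < (2 * C₀) ^ (1 / (1 - min ε 1 / 3)) * ((rad a b c : ℕ) : ℝ) ^ (1 + ε) := by
    positivity
  calc (c : ℝ) ≤ (2 * C₀) ^ (1 / (1 - min ε 1 / 3)) *
        ((rad a b c : ℕ) : ℝ) ^ ((1 + min ε 1 / 3) / (1 - min ε 1 / 3)) := habs
    _ ≤ (2 * C₀) ^ (1 / (1 - min ε 1 / 3)) * ((rad a b c : ℕ) : ℝ) ^ (1 + ε) :=
        mul_le_mul_of_nonneg_left (Real.rpow_le_rpow_of_exponent_le hrad1 hexp) (by positivity)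
    _ < 2 * (2 * C₀) ^ (1 / (1 - min ε 1 / 3)) * ((rad a b c : ℕ) : ℝ) ^ (1 + ε) := by linarith

/-- **The crux ⟹ `G`** (through its level-one rung, `levelOneRung_of_uniformSadicTowerFour`). [folklore] -/
theorem tPart_of_uniformSadicTowerFour (hU : UniformSadicTowerFour) :
    ∀ W : ℕ, ∀ ε : ℝ, 0 < ε → ∃ C : ℝ, 0 < C ∧ ∀ T : Finset ℕ, T.card ≤ W → (∀ p ∈ T, Nat.Prime p) →
      ∀ u v : ℕ, 0 < v → v < u → Nat.Coprime u v → (u * v).primeFactors.card ≤ W →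
        ((∏ p ∈ T, p ^ (u - v).factorization p : ℕ) : ℝ) ≤
          C * (((∏ p ∈ T, p) * radical (u * v) : ℕ) : ℝ) ^ (1 + ε) * (u : ℝ) ^ ε :=
  tPart_of_levelOneRung (levelOneRung_of_uniformSadicTowerFour hU)

/-- **Modulo crux #6 the crux IS the `T`-part face `G`:** under `DeepRegimeABC`,
`UniformSadicTowerFour ⟺ G` (`→`: `tPart_of_uniformSadicTowerFour`; `←`: `boundedOmega_of_tPart` and
`HeavyPlaces.uniformSadicTowerFour_iff_boundedOmega_of_deepRegimeABC`). [folklore] -/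
theorem uniformSadicTowerFour_iff_tPart_of_deepRegimeABC (h₆ : DeepRegimeABC) :
    UniformSadicTowerFour ↔
    ∀ W : ℕ, ∀ ε : ℝ, 0 < ε → ∃ C : ℝ, 0 < C ∧ ∀ T : Finset ℕ, T.card ≤ W → (∀ p ∈ T, Nat.Prime p) →
      ∀ u v : ℕ, 0 < v → v < u → Nat.Coprime u v → (u * v).primeFactors.card ≤ W →
        ((∏ p ∈ T, p ^ (u - v).factorization p : ℕ) : ℝ) ≤
          C * (((∏ p ∈ T, p) * radical (u * v) : ℕ) : ℝ) ^ (1 + ε) * (u : ℝ) ^ ε :=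
  ⟨tPart_of_uniformSadicTowerFour,
    fun hG => (uniformSadicTowerFour_iff_boundedOmega_of_deepRegimeABC h₆).mpr (boundedOmega_of_tPart hG)⟩

end Summit.ABC.ABC.Theorems.UniformSadicTowerFour.BoundedOmega

end
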